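import Summits.BirchSwinnertonDyer.BirchSwinnertonDyer.Theorems.ResidualThetaTransportAtTwoThetaLayerLambdaCongruenceAtTwoCuspSpanEllipticFamiliesQuadratic
import HarnessLib

/-!
# Route `ResidualThetaTransportAtTwo`, cruxes Kan⁺ (stmt-BirchSwinnertonDyer-20688) / Kμ⁺ (20689) / 21437: FLAT at `2`
# (`2 ∤ L⁻` for every Pollack pair) for EVERY curve good supersingular at `2` with `a₂ = 0` whose conductor is a prime of the
# class-wide families B′ / E′ / C′ (`…CuspSpanEllipticFamilies`, `…CuspSpanEllipticFamiliesQuadratic`)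

Cell `bsd-wall`, width seat `bsd-wall-rtt-p3-w3` g7 (2026-08-28). THEOREMS ONLY; `--supports stmt-BirchSwinnertonDyer-20688`; BSD is not
proved by this. The lead's `flatAtTwo_of_units_four_pow` (Theorem A conductors) extended to the three new families: for
`W/ℚ` good supersingular at `2` with `a₂(W) = 0`, newform `f`, and PRIME conductor `p` with
* (B′) `i² = −1` and every unit of `ℤ/p` of the form `4^k i^j` (⟺ `p ≡ 5 (mod 8)` and `2` is a primitive root:
  `29, 37, 53, 61, 101, 149, 173, 181, 197, 269, 293, 317, …`), or
* (E′) `ρ² + ρ + 1 = 0` and every unit of the form `±4^k ρ^j` (`31, 43, 223, 283, 439, 499, …`), or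
* (C′) `p ≡ 9 (mod 16)`, `ζ⁴ = −1`, `−1 ∈ ⟨4⟩`, every unit of the form `4^k ζ^j` (`41, 137, 313, 409, 521, 569, …`),
**`2 ∤ L⁻` for every Pollack pair `(L⁺, L⁻)` of `f` at `2`** — crux Kμ⁺'s FLAT statement, a THEOREM on these classes with no
certificate and no conjecture-grade input (`flatAtTwo_of_cuspSpanEvenAtTwo` over the uniform node theorems). Primitive-root forms
(`…_of_orderOf_…`) make the hypotheses three `decide` checks per conductor.

References: R. Pollack, Duke Math. J. 118 (2003) Conj. 6.3 and Prop. 6.18 [Pollack2003]; H. Rademacher, Abh. Math. Sem. Hamburg 7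
(1929) §1 [Rademacher1929].
-/

set_option autoImplicit false
set_option linter.dupNamespace false

noncomputable section

open scoped MatrixGroups

open CongruenceSubgroup WeierstrassCurve Literature.NumberTheory.EllipticCurves
  Literature.NumberTheory.EllipticCurves.ModularForms Literature.NumberTheory.EllipticCurves.Rank1Residual
  Literature.NumberTheory.IwasawaTheory Summit.BirchSwinnertonDyer.Rank1Residual.Supersingular

namespace Summit.BirchSwinnertonDyer.BirchSwinnertonDyer.Theorems.SignedMuAtTwo

variable {W : WeierstrassCurve ℚ} [W.IsElliptic] [W.IsGloballyMinimal]

omit [W.IsElliptic] [W.IsGloballyMinimal] in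
/-- Transport of the node along `N_W = p`. [folklore] -/
theorem cuspSpanEvenAtTwo_conductor_of_eq [NeZero (W.conductorNorm ℤ)] {p : ℕ} [NeZero p] (hN : W.conductorNorm ℤ = p)
    (h : CuspSpanEvenAtTwo p) : CuspSpanEvenAtTwo (W.conductorNorm ℤ) := by
  revert h
  generalize hM : W.conductorNorm ℤ = M at *
  subst hN
  exact id

/-- **FLAT on family B′.** `W` good supersingular at `2`, `a₂ = 0`, prime conductor `p` with `i² = −1` in `ℤ/p` and every unit
`= 4^k i^j`: `2 ∤ L⁻` for every Pollack pair of the newform. [cite: Pollack2003, Conj. 6.3 and Prop. 6.18] -/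
theorem flatAtTwo_of_conductor_prime_rootNegOne [NeZero (W.conductorNorm ℤ)] {f : CuspForm (Gamma0 (W.conductorNorm ℤ)) 2}
    (hf : IsNewformOf W f) (hss : GoodSS W 2) (ha : W.frobeniusTrace 2 = 0) {p : ℕ} [Fact p.Prime]
    (hN : W.conductorNorm ℤ = p) (hp2 : p ≠ 2) (i : ZMod p) (hi : i * i = -1)
    (hU : ∀ u : ZMod p, u ≠ 0 → ∃ k j : ℕ, u = 4 ^ k * i ^ j) :
    ∀ Lplus Lminus : IwasawaAlgebra 2, IsPollackPair f 2 Lplus Lminus → ¬ PowerSeries.C (2 : ℤ_[2]) ∣ Lminus :=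
  flatAtTwo_of_cuspSpanEvenAtTwo hf hss ha
    (cuspSpanEvenAtTwo_conductor_of_eq hN (cuspSpanEvenAtTwo_of_units_four_pow_mul_rootNegOne_pow hp2 i hi hU))

/-- **FLAT on family B′, primitive-root form** (`orderOf g = p − 1`, `i² = −1`, `g = 4^a i^b`).
[cite: Pollack2003, Conj. 6.3 and Prop. 6.18] -/
theorem flatAtTwo_of_conductor_prime_of_orderOf_rootNegOne [NeZero (W.conductorNorm ℤ)]
    {f : CuspForm (Gamma0 (W.conductorNorm ℤ)) 2} (hf : IsNewformOf W f) (hss : GoodSS W 2) (ha : W.frobeniusTrace 2 = 0)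
    {p : ℕ} [Fact p.Prime] (hN : W.conductorNorm ℤ = p) (hp2 : p ≠ 2) (g i : ZMod p) (hg : orderOf g = p - 1)
    (hi : i * i = -1) (a b : ℕ) (hgab : g = 4 ^ a * i ^ b) :
    ∀ Lplus Lminus : IwasawaAlgebra 2, IsPollackPair f 2 Lplus Lminus → ¬ PowerSeries.C (2 : ℤ_[2]) ∣ Lminus :=
  flatAtTwo_of_cuspSpanEvenAtTwo hf hss ha
    (cuspSpanEvenAtTwo_conductor_of_eq hN (cuspSpanEvenAtTwo_of_orderOf_of_rootNegOne hp2 g i hg hi a b hgab))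

/-- **FLAT on family E′.** `W` good supersingular at `2`, `a₂ = 0`, prime conductor `p` with `ρ² + ρ + 1 = 0` in `ℤ/p` and every
unit `= ±4^k ρ^j`: `2 ∤ L⁻` for every Pollack pair of the newform. [cite: Pollack2003, Conj. 6.3 and Prop. 6.18] -/
theorem flatAtTwo_of_conductor_prime_rootCube [NeZero (W.conductorNorm ℤ)] {f : CuspForm (Gamma0 (W.conductorNorm ℤ)) 2}
    (hf : IsNewformOf W f) (hss : GoodSS W 2) (ha : W.frobeniusTrace 2 = 0) {p : ℕ} [Fact p.Prime]
    (hN : W.conductorNorm ℤ = p) (hp2 : p ≠ 2) (ρ : ZMod p) (hρ : ρ * ρ + ρ + 1 = 0)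
    (hU : ∀ u : ZMod p, u ≠ 0 → ∃ k j : ℕ, u = 4 ^ k * ρ ^ j ∨ u = -(4 ^ k * ρ ^ j)) :
    ∀ Lplus Lminus : IwasawaAlgebra 2, IsPollackPair f 2 Lplus Lminus → ¬ PowerSeries.C (2 : ℤ_[2]) ∣ Lminus :=
  flatAtTwo_of_cuspSpanEvenAtTwo hf hss ha
    (cuspSpanEvenAtTwo_conductor_of_eq hN (cuspSpanEvenAtTwo_of_units_pm_four_pow_mul_rootCube_pow hp2 ρ hρ hU))

/-- **FLAT on family E′, primitive-root form** (`orderOf g = p − 1`, `ρ² + ρ + 1 = 0`, `g = ±4^a ρ^b`).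
[cite: Pollack2003, Conj. 6.3 and Prop. 6.18] -/
theorem flatAtTwo_of_conductor_prime_of_orderOf_rootCube [NeZero (W.conductorNorm ℤ)]
    {f : CuspForm (Gamma0 (W.conductorNorm ℤ)) 2} (hf : IsNewformOf W f) (hss : GoodSS W 2) (ha : W.frobeniusTrace 2 = 0)
    {p : ℕ} [Fact p.Prime] (hN : W.conductorNorm ℤ = p) (hp2 : p ≠ 2) (g ρ : ZMod p) (hg : orderOf g = p - 1)
    (hρ : ρ * ρ + ρ + 1 = 0) (a b : ℕ) (hgab : g = 4 ^ a * ρ ^ b ∨ g = -(4 ^ a * ρ ^ b)) :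
    ∀ Lplus Lminus : IwasawaAlgebra 2, IsPollackPair f 2 Lplus Lminus → ¬ PowerSeries.C (2 : ℤ_[2]) ∣ Lminus :=
  flatAtTwo_of_cuspSpanEvenAtTwo hf hss ha
    (cuspSpanEvenAtTwo_conductor_of_eq hN (cuspSpanEvenAtTwo_of_orderOf_of_rootCube hp2 g ρ hg hρ a b hgab))

/-- **FLAT on family C′.** `W` good supersingular at `2`, `a₂ = 0`, prime conductor `p ≡ 9 (mod 16)` with `ζ⁴ = −1`, `4^{k₀} = −1`
and every unit `= 4^k ζ^j`: `2 ∤ L⁻` for every Pollack pair of the newform. [cite: Pollack2003, Conj. 6.3 and Prop. 6.18] -/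
theorem flatAtTwo_of_conductor_prime_rootEight [NeZero (W.conductorNorm ℤ)] {f : CuspForm (Gamma0 (W.conductorNorm ℤ)) 2}
    (hf : IsNewformOf W f) (hss : GoodSS W 2) (ha : W.frobeniusTrace 2 = 0) {p : ℕ} [Fact p.Prime]
    (hN : W.conductorNorm ℤ = p) (hp2 : p ≠ 2) (h16 : p % 16 = 9) (ζ : ZMod p) (hζ : ζ ^ 4 = -1) (k₀ : ℕ)
    (hk₀ : (4 : ZMod p) ^ k₀ = -1) (hU : ∀ u : ZMod p, u ≠ 0 → ∃ k j : ℕ, u = 4 ^ k * ζ ^ j) :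
    ∀ Lplus Lminus : IwasawaAlgebra 2, IsPollackPair f 2 Lplus Lminus → ¬ PowerSeries.C (2 : ℤ_[2]) ∣ Lminus :=
  flatAtTwo_of_cuspSpanEvenAtTwo hf hss ha
    (cuspSpanEvenAtTwo_conductor_of_eq hN (cuspSpanEvenAtTwo_of_units_four_pow_mul_rootEight_pow hp2 h16 ζ hζ k₀ hk₀ hU))

/-- **FLAT on family C′, primitive-root form.** [cite: Pollack2003, Conj. 6.3 and Prop. 6.18] -/
theorem flatAtTwo_of_conductor_prime_of_orderOf_rootEight [NeZero (W.conductorNorm ℤ)]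
    {f : CuspForm (Gamma0 (W.conductorNorm ℤ)) 2} (hf : IsNewformOf W f) (hss : GoodSS W 2) (ha : W.frobeniusTrace 2 = 0)
    {p : ℕ} [Fact p.Prime] (hN : W.conductorNorm ℤ = p) (hp2 : p ≠ 2) (h16 : p % 16 = 9) (g ζ : ZMod p)
    (hg : orderOf g = p - 1) (hζ : ζ ^ 4 = -1) (k₀ : ℕ) (hk₀ : (4 : ZMod p) ^ k₀ = -1) (a b : ℕ)
    (hgab : g = 4 ^ a * ζ ^ b) :
    ∀ Lplus Lminus : IwasawaAlgebra 2, IsPollackPair f 2 Lplus Lminus → ¬ PowerSeries.C (2 : ℤ_[2]) ∣ Lminus :=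
  flatAtTwo_of_cuspSpanEvenAtTwo hf hss ha
    (cuspSpanEvenAtTwo_conductor_of_eq hN
      (cuspSpanEvenAtTwo_of_orderOf_of_rootEight hp2 h16 g ζ hg hζ k₀ hk₀ a b hgab))

/-- **Example: FLAT at conductor `61`** (family B′: `2` primitive mod `61`, `i = 11`, `2 = 4^8·11^3`) — e.g. for every `W` good
supersingular at `2` with `a₂ = 0` and `N_W = 61`. [cite: Pollack2003, Conj. 6.3 and Prop. 6.18] -/
theorem flatAtTwo_of_conductor_sixtyone_uniform [NeZero (W.conductorNorm ℤ)] {f : CuspForm (Gamma0 (W.conductorNorm ℤ)) 2}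
    (hf : IsNewformOf W f) (hss : GoodSS W 2) (ha : W.frobeniusTrace 2 = 0) (hN : W.conductorNorm ℤ = 61) :
    ∀ Lplus Lminus : IwasawaAlgebra 2, IsPollackPair f 2 Lplus Lminus → ¬ PowerSeries.C (2 : ℤ_[2]) ∣ Lminus := by
  have h1 : (2 : ZMod 61) ^ 60 = 1 := by decide +kernel
  have h2 : ∀ q, q < 60 + 1 → 2 ≤ q → q ∣ 60 → (2 : ZMod 61) ^ (60 / q) ≠ 1 := by decide +kernel
  have hi : (11 : ZMod 61) * 11 = -1 := by decide +kernel
  have hg : (2 : ZMod 61) = 4 ^ 8 * 11 ^ 3 := by decide +kernel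
  haveI : Fact (Nat.Prime 61) := ⟨by norm_num⟩
  exact flatAtTwo_of_conductor_prime_of_orderOf_rootNegOne hf hss ha hN (by norm_num) 2 11
    (orderOf_eq_of_pow_eq_one_of_forall_dvd (2 : ZMod 61) 60 (by norm_num) h1 h2) hi 8 3 hg

end Summit.BirchSwinnertonDyer.BirchSwinnertonDyer.Theorems.SignedMuAtTwo

end
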